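import Literature.MathematicalPhysics.QuantumFieldTheory.Balaban1983to89.B7Prop1Explicit

/-!
# Bałaban's renormalization group for 4-d lattice Yang–Mills — B7 Proposition 2 (52)–(54), the regularity of the
`k`-fold average `|Ū^k(∂p) − 1| < α₀ + 2C₀α₀² < 2α₀`, PROVED for the concrete iterated block average (43) on `ℤ^d`,
uniformly in `k`, for `U(N)`-valued configurations, with the explicit `C₀(d)`, `c₂′(d, L)` of `B7Prop1Explicit`
(`B7Prop2Explicit`)

CITATION HEADER (lean-in-tree rule 2026-08-18).  Audit cell `pub-balaban`, paper sub-cell B07 (unit b2b-balaban-b07,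
gen 14).  Source: T. Bałaban, *Averaging operations for lattice gauge theories*, Commun. Math. Phys. **98**, 17–51
(1985) [Balaban1985Averaging] (cell paper B7; journal page = PDF page + 16), pp. 17–19, 23–24, 26 [PDF 1–3, 7–8, 10],
quoted from the page renders `b2b-balaban-ref1/pages/1985-cmp98-averaging/1985-cmp98-averaging-p001-x2.png`, `-p002`,
`-p003`, `-p007`, `-p008`, `-p010-x2.png` READ AS IMAGES.  Companions, used BY NAME: `B7Prop1Explicit` (gen 13:
Proposition 1 (51) certified for the concrete average (42) on `ℤ^d` with explicit constants — `prop1_explicit`, and its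
machinery `hol`, `plaqWord`, `bavg`, `Wcx`, `cplaq`, `axialFn`, `axial_bond_bound`, `bond_log`, `side_estimate`,
`Wcx_gaugeAct`, `norm_sub_one_le_of_conj`; THIS FILE ITERATES IT), `B7` (the quoted leaf `B7.Prop2Printed` and the
abstract carrier `B7.KStep`, which THIS FILE INSTANTIATES AND PROVES, and the kernel-checked arithmetic of (53)–(54):
`B7.ineq53_induction`, `B7.prop2_of_ineq53`, `B7.geom_bracket_le_two`, `B7.prop2_ratio_lt_half`,
`B7.prop2_bound_lt_two_alpha`), `MatrixLog` ((21), (26): `mlog`, `exp_mlog`, `norm_mlog_le_two_mul`), `B7BlockAvgLog`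
(`mlog_exp`: `log ∘ exp = id` on `|C| < ln 2`), Mathlib (`NormedSpace.exp_mem_unitary_of_mem_skewAdjoint`,
`NormedSpace.star_exp`, `CStarRing.norm_of_mem_unitary`; the C⋆-algebra structure of `M_N(ℂ)` with the operator norm,
scope `Matrix.Norms.L2Operator`).  v1.0.1 is a DOCSTRING-ONLY correction of v1 (p184745): the locator of the operator
norm, "(17) p. 20" in v1, is (19) p. 21 (cross-read note R2 of GAPS C-pv15g7-3 on the companion `B7Prop1Explicit`
applies verbatim here); all declarations unchanged.

THE PRINTED TEXT.  p. 17: "We consider a subdomain `Ω` of the lattice `ηZ^d` with a lattice spacing `η`. A sequence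
of sets `Ω^{(j)}` is defined as the intersections `Ω^{(j)} = Ω ∩ L^jηZ^d`, (1) where `L` is a fixed integer, `L > 1`.
For a point `y ∈ L^nηZ^d` (or any lattice `δZ^d`), we define a block of an order `j` as the cube `B^j(y) = {x ∈
L^{−j}L^nηZ^d : y_μ ≤ x_μ < y_μ + L^nη, μ = 1, …, d}` (2) … We will omit the subscript `j` if `j = 1`."  p. 18: "In
fact, we will assume that `η = L^{−k}`."; "positively oriented plaquettes … `p = ⟨x, x + ηe_μ, x + ηe_μ + ηe_ν,
x + ηe_ν⟩, μ < ν`. (5)"; "Gauge field configurations `U` are defined on a set of bonds in `Ω`, and with values in a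
Lie subgroup `G` of a unitary group `U(N)`."; (7) `U(x, x′) = U⁻¹(x′, x) = U*(x′, x)`; (9) `U(Γ) = Π U(x_i, x_{i+1})`,
"This definition will be applied also to contours on arbitrary lattices. For a plaquette `p = ⟨x, y, z, w⟩` we define
`∂p` as the oriented contour `∂p = ⟨x,y⟩ ∪ ⟨y,z⟩ ∪ ⟨z,w⟩ ∪ ⟨w,x⟩`, and `U(∂p)` is defined by (9)."  p. 19: "an
averaging operation `Ū`. It transforms a configuration `U` defined on `Ω^{(j)}` into a configuration `Ū` defined on
`Ω^{(j+1)}`. In fact, `Ω^{(j)}` may be replaced by any other lattice."; (11) "`\overline{U^u}(y, y′) = u(y)Ū(y, y′)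
u⁻¹(y′)`, or `\overline{U^u} = (Ū)^u`."  p. 23, Sect. B: "Let us recall the basic definitions. Let `U` be a gauge field
configuration with values in `U(N)`. The one-step averaging operation is defined by `Ū_c = exp[i Σ_{x∈B(c₋)} L^{−d}
(1/i) log U(Γ_{c,x}) U(c)⁻¹] U(c)`, `c ⊂ Ω^{(1)}`, (42)"  p. 24: "and if `k`-th order averaging `Ū^k` is defined at
bonds of `Ω^{(k)}`, then `Ū^{k+1}_c = \overline{(Ū^k)}_c = exp[i Σ_{x∈B(c₋)} L^{−d} (1/i) log Ū^k(Γ_{c,x})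
(Ū^k(c))⁻¹] Ū^k(c)`, `c ⊂ Ω^{(k+1)}`, (43) where the contours `Γ_{c,x}` are defined on the lattice `Ω^{(k)}`.  Let us
notice that this definition is local in the sense that `Ū^k_c`, `c ⊂ Ω^{(k)}`, depends only on the bond variables
`U_b` for `b ⊂ B^k(c₋) ∪ B^k(c₊)`. … thus the matrices `U^u(Γ_{c,x})U^u(c)⁻¹` and `U(Γ_{c,x})U(c)⁻¹` are unitarily
equivalent, their eigenvalues are equal, and by the definition (22) their logarithms are unitarily equivalent with
the same unitary operator `u(c₋)`. Then from (42) we get `(\overline{U^u})_c = u(c₋)Ū_c u⁻¹(c₊)`."  p. 26 [PDF 10],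
after Proposition 1 (51) (certified in `B7Prop1Explicit`): "Now it becomes obvious what assumption we have to make for
a configuration `U` in order to get a bound on `Ū^k(∂p) − 1`, `p ⊂ Ω^{(k)}`. Each averaging operation rescales a bound
on plaquette variables approximately by the factor `L²`, hence `k` operations by the factor `L^{2k}`. To get some small
number yet, we have to assume that `|U(∂p) − 1| < α₀η²`, `η = L^{−k}` (52) on some set of plaquettes. If `α₀ ≤ c₂′`,
then by the above Proposition, `|Ū(∂p′) − 1| < L²α₀η² + C₀(L²α₀η²)`. We take `k ≥ 1` so `α₀L²η² + C₀(α₀L²η²)² ≤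
α₀ + C₀α₀²` and we assume further that `α₀ + C₀α₀² ≤ c₂′`. Applying the Proposition again, we get for `p″ ⊂ Ω^{(2)}`
`|Ū²(∂p″) − 1| < … ≤ α₀L⁴η² + C₀(α₀L⁴η²)²[1 + L^{−2}(1 + C₀α₀)²]`.  We make the following inductive assumption for
`j ≤ k`: `|Ū^j(∂p) − 1| < α₀L^{2j}η² + C₀(α₀L^{2j}η²)²·[1 + L^{−2}(1+C₀α₀)² + … + L^{−2(j−1)}(1+C₀α₀)^{2(j−1)}]`.
(53)  The right-hand side can be bounded by `α₀ + C₀α₀²2` if `L^{−2}(1 + C₀α₀)² < ½`. The last inequality holds if,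
e.g., `C₀α₀ ≤ ⅓`, and then `α₀ + C₀α₀²2 < 2α₀`. We assume further that `2α₀ ≤ c₂′`. Then for `j < k`, we can apply
Proposition 1 to the configuration `Ū^j` and we get for `p ⊂ Ω^{(j+1)}` `|Ū^{j+1}(∂p) − 1| < α₀L^{2(j+1)}η² +
C₀L²(α₀L^{2j}η²)²[1 + …] + C₀(α₀L^{2(j+1)}η² + C₀L²(α₀L^{2j}η²)²[1 + …])² ≤ α₀L^{2(j+1)}η² + C₀(α₀L^{2(j+1)}η²)²
{1 + [1 + …]L^{−2}(1 + C₀α₀)²}`. Thus the inequality (53) is proved for all `j ≤ k`. Taking `j = k`, we get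
**Proposition 2.** If `U` satisfies (52) with `α₀ ≤ c₂ = min{1/(3C₀), ½c₂′}`, then `|Ū^k(∂p) − 1| < α₀ + 2C₀α₀² <
2α₀`, `p ⊂ Ω^{(k)}`. (54)  The result is local in the sense that if `p = ⟨x, y, z, w⟩`, then it is enough to assume
(52) for `p ⊂ B^k(x) ∪ B^k(y) ∪ B^k(z) ∪ B^k(w)`."

DICTIONARY print ↦ Lean (this namespace; the objects of `B7Prop1Explicit` are re-used: `Site d = ℤ^d`, words
`List (Letter d)`, (9) `hol`, (8) `gaugeAct`, `∂p` ↦ `plaqWord μ ν`, (42) ↦ `bavg L V` with exponent `Xavg` and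
`log`-arguments `Wcx`, the `L`-plaquette variable `V̄(∂p′)` ↦ `cplaq`).  SCALES: every lattice `Ω^{(j)} = L^jηZ^d`
(`Ω = ηZ^d`, the whole space) is identified with `ℤ^d` by `x ↦ x/(L^jη)` — plaquette variables (9) are products of
bond variables and do not see the spacing — so a configuration on `Ω^{(j)}` is a `V : Site d → Fin d → 𝔸ˣ`
(`V(x, κ) = U(⟨L^jηx, L^jη(x + e_κ)⟩)`), the bonds of `Ω^{(j+1)}` are the `L`-bonds `⟨q, q + Le_κ⟩`, `q ∈ Lℤ^d`, of
`Ω^{(j)} ≅ ℤ^d`, and (43) = the one-step average (42) of `B7Prop1Explicit` followed by the re-identification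
`Lℤ^d ≅ ℤ^d`: `rescale L W (z, κ) = W(Lz, κ)`; hence `Ū^j` ↦ `avgIter L V j` (`avgIter L V (j+1) = rescale L (bavg L
(avgIter L V j))`), and `Ū^j(∂p)`, `p ⊂ Ω^{(j)}` ↦ `hol (avgIter L V j) z (plaqWord μ ν)` (`hol_rescale_plaqWord`:
this IS the `L`-plaquette variable `cplaq` of the previous level, the quantity bounded by Prop. 1).  `sup_{p ⊂ Ω^{(j)}}
|Ū^j(∂p) − 1|` ↦ `pdev (avgIter L V j)` (a real `iSup` over ALL `(z; μ, ν)`, the degenerate words `μ = ν` having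
holonomy `1`; both orientations `μ < ν`, `ν < μ` included, harmlessly).  (52) ↦ `pdev V < α₀ * ((L^k)⁻¹)²`; in the
leaf `B7.KStep`: `plaqDevEta = pdev V · (L^k)²` (= `sup |U(∂p) − 1| η^{−2}`), `avgDevK = pdev (avgIter L V k)`.
`G = U(N)` ↦ a subgroup `G ≤ 𝔸ˣ` of the units of a complete normed `ℂ`-algebra `𝔸` with `‖1‖ = 1` which is
`AvgClosed` (below); instances: the unitary group `unitaryUnits 𝔸` of any non-trivial C⋆-algebra
(`avgClosed_unitaryUnits`), in particular of `𝔸 = M_N(ℂ)` with the operator norm (19), i.e. `G = U(N)` itself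
(`prop2Printed_unitaryGroup`).  The constants: `C0 d = 226·(8(d+1)(d+4))²`, `c2' d L = 1/(512(d+1)(d+4)L²)` (those
of `B7Prop1Explicit.prop1_explicit`), `c₂ = min{1/(3C₀), ½c₂′}` verbatim (`B7.Prop2Printed`).

WHAT THIS FILE PROVES (kernel, no `sorry`, axioms `propext`, `Classical.choice`, `Quot.sound`).
* `prop2Printed_unitaryGroup (N) [NeZero N] (L) (hL : 2 ≤ L) : B7.Prop2Printed (C0 d) (c2' d L) (fun k ↦
  concreteKStep d (Matrix (Fin N) (Fin N) ℂ) (unitaryUnits _) L k)` — PROPOSITION 2 AS PRINTED (the quoted leaf of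
  `B7.lean`), for the paper's own objects: `U(N)`-valued configurations, the `k`-fold average (43), operator norm,
  every `k ∈ ℕ`, every `d`, every `L ≥ 2`, with the constants of the certified Prop. 1; more generally
  `prop2Printed_unitaryUnits` (unitary group of any non-trivial C⋆-algebra) and `prop2Printed_concrete` (any
  `AvgClosed` group).
* `prop2_explicit` — (54) with all hypotheses explicit: `V` `G`-valued, `0 < α₀`, `C₀α₀ ≤ ⅓`, `2α₀ ≤ c₂′`,
  `pdev V < α₀(L^{−k})²` ⟹ `pdev (avgIter L V k) < α₀ + 2C₀α₀²` AND every `Ū^j`, `j ≤ k`, is `G`-valued;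
  `prop2_explicit_lt_two` — `< 2α₀`; `ineq53_explicit` — the inductive inequality (53) for all `j ≤ k`.
* The printed induction, step by step: `step_lt` / `step_avgIter` (Prop. 1 applied to `Ū^j` at EVERY plaquette of
  `Ω^{(j+1)}`, then the supremum: `pdev < P ≤ c₂′ ⟹ pdev(next level) < L²P + C₀(L²P)²` — the hypothesis `step` of
  `B7.ineq53_induction`); `avgIter_mem` (the tacit clause "we can apply Proposition 1 to the configuration `Ū^j`":
  `Ū^j` is again a `G`-valued configuration whose `log`-arguments lie in the domain of (21), by induction on `j` using
  (53) at level `j` — `B7.ineq53_induction` invoked with `k := j` — and `norm_Wcx_sub_one_le`); `bound53_le` +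
  `B7.geom_bracket_le_two` + `B7.prop2_ratio_lt_half` ("The right-hand side can be bounded by `α₀ + C₀α₀²2` if
  `L^{−2}(1 + C₀α₀)² < ½` … if, e.g., `C₀α₀ ≤ ⅓`").
* `norm_Wcx_sub_one_le` — p. 25 "`|V₀(Γ_{c,x}) − 1| < … = O(1)L²α₀`" made gauge-free and global: under (44) with
  constant `α₀`, `512(d+1)(d+4)L²α₀ ≤ 1`, EVERY `|V(Γ_{c,x})V(c)⁻¹ − 1| ≤ 2θ ≤ 1/32`, `θ = 8(d+1)(d+4)L²α₀`, at every
  `L`-bond of `ℤ^d` (the last clause of `B7Prop1Explicit.side_estimate` in the axial gauge at `y = c₋ + 2Le_κ`,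
  transported by (11)).
* `AvgClosed d L G` (STRUCTURE, the one property of `G` needed beyond `G ⊂ {|u| ≤ 1, |u⁻¹| ≤ 1}`: the average (42) of
  a `G`-valued configuration is `G`-valued at every bond whose `log`-arguments are within `1/4` of `1`) and its
  instance `avgClosed_unitaryUnits` for the unitary group of a C⋆-algebra: `star_mlog_eq_neg` ((22)–(23): the
  logarithm (21) of a unitary `u` with `|u − 1| ≤ 1/4` is skew-adjoint, via `e^{X⋆} = (e^X)⋆ = u⋆ = u⁻¹ = e^{−X}` and
  the injectivity of `exp` on `|X| < ln 2` from `B7BlockAvgLog.mlog_exp`), `bavg_mem_unitaryUnits` (a real average of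
  skew-adjoint elements is skew-adjoint, its exponential unitary — Mathlib — and `V̄_c = e^{X_c}V(c)` is unitary).

METHOD = the printed proof of p. 26, with the arithmetic of (53) taken from `B7.lean` (where it was kernel-checked
abstractly over ANY family satisfying the conclusion of Prop. 1) and the conclusion of Prop. 1 supplied by
`B7Prop1Explicit.prop1_explicit` at every level.  The one addition print does not spell out: to "apply Proposition 1
to the configuration `Ū^j`" one needs `Ū^j` to be a `U(N)`-valued configuration again, i.e. (42) must have been
evaluated inside the domain of the logarithm (21) at all lower levels; this is proved here TOGETHER with (53), by a
single induction on the level `j₀ ≤ k` whose hypothesis is "all `Ū^i`, `i ≤ j₀`, are `G`-valued": (53) at level `j₀`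
(from the steps `i < j₀`, available by the induction hypothesis) gives `sup |Ū^{j₀}(∂p) − 1| < α₀ + 2C₀α₀² < 2α₀ ≤
c₂′`, hence (`norm_Wcx_sub_one_le`) all `log`-arguments of the next average are within `1/32` of `1`, and `AvgClosed`
gives the `G`-valuedness of `Ū^{j₀+1}`.  The strict `<` of (52)/(54) is carried throughout (`pdev` is a genuine
supremum, bounded by `2`; Prop. 1 is applied with the constant `P`, `pdev < P`, in its `≤`-form `prop1_explicit` and
the strictness comes from `pdev < P`).

DIVERGENCES / WHAT IS NOT REPRODUCED (cell DIVERGENCE.md D-b07g14.1).  (a) LOCALITY: (52) is assumed for ALL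
plaquettes of `Ω = ηZ^d` ("on some set of plaquettes" / the locality remark after (54) — "enough to assume (52) for
`p ⊂ B^k(x) ∪ B^k(y) ∪ B^k(z) ∪ B^k(w)`" — is NOT certified; it would need the local form of Prop. 1, itself not
certified in `B7Prop1Explicit`, DIVERGENCE D-b07g13.1 (a)).  (b) SETTING: the whole space `ηZ^d ≅ ℤ^d` (no torus, no
subdomain `Ω`; (4) plays no role); `G = U(N)` generalised to any `AvgClosed` subgroup of the units of a complete normed
`ℂ`-algebra with `‖1‖ = 1` — certified instances: the full unitary group of a non-trivial C⋆-algebra, in particular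
`U(N) ⊂ M_N(ℂ)`, `N ≥ 1`; a proper "Lie subgroup `G` of `U(N)`" (p. 18), e.g. `SU(N)`, is NOT treated (it would need
`det V̄_c = 1`, i.e. `tr log = log det` for (21), not in the tree).  (c) `L ≥ 2` (print: "`L > 1`" p. 17 — the same);
`k = 0` is allowed (print takes `k ≥ 1`; for `k = 0` (54) is (52)).  (d) `pdev` ranges over all pairs `(μ, ν)`
including `ν < μ` (the reversed orientation, `|U(∂p)⁻¹ − 1|`; for unitary `U` the same number) and `μ = ν`
(holonomy `1`); this only strengthens the hypothesis (52) formally and is implied by it for `U(N)` (where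
`|U⁻¹ − 1| = |U − 1|`), and strengthens the conclusion.  (e) CONSTANTS: `C₀ = 14464(d+1)²(d+4)²`, `c₂′ =
1/(512(d+1)(d+4)L²)` are the admissible witnesses of `B7Prop1Explicit`, not optimal; `c₂ = min{1/(3C₀), ½c₂′}`
exactly as printed.  (f) Not touched: Proposition 3 (analyticity, Sect. B pp. 27–36) and Sects. C–F.

FINDINGS OF THE AUDIT (cell GAPS.md C-b07g14-1).  The printed proof of Proposition 2 is correct and complete given
Proposition 1; the induction (53) closes exactly as printed under `C₀α₀ ≤ ⅓`, `2α₀ ≤ c₂′` (`L ≥ 2` gives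
`L^{−2}(1 + C₀α₀)² ≤ (4/3)²/4 = 4/9 < ½`), and the bracket is `≤ 2`.  Remarks: (1) the clause left tacit in print —
that every `Ū^j`, `j < k`, is again a `U(N)`-valued configuration on which (43) is defined through the series (21),
i.e. `|Ū^j(Γ_{c,x})Ū^j(c)⁻¹ − 1| < 1` — holds with the margin `≤ 1/32` under the printed hypotheses (it is the p. 25
estimate `O(1)L²·(2α₀)` at level `j`), and is certified here (`avgIter_mem`); (2) MISPRINT p. 26 l. 7: "`|Ū(∂p′) − 1| <
L²α₀η² + C₀(L²α₀η²)`" should read `… + C₀(L²α₀η²)²` (the square is present in the next sentence and in (51));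
harmless (misprint list G-B7-08, addendum).  VALUE = the second numbered proposition of B7 kernel-checked for the
paper's own concrete objects, now INCLUDING the gauge group `U(N) ⊂ M_N(ℂ)` with the operator norm: the quoted leaf
`B7.Prop2Printed` is PROVED (not assumed) for the family of `k`-fold averages (43), uniformly in `k` — the form in
which (54) is consumed downstream (small-field conditions of B11/B12).  NOT summit progress by itself (ultraviolet
stability needs Prop. 3 and papers B8–B13).
-/

noncomputable section

open scoped BigOperators
open NormedSpace Finset

namespace Literature.MathematicalPhysics.QuantumFieldTheory.Balaban1983to89.B7Prop2Explicit

open B7Prop1Explicit MatrixLog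

-- `Site` alone would resolve to the torus sites `Balaban1983to89.Site (P : Params) j` of `Setup.lean` (parent
-- namespace beats `open`); re-export the `ℤ^d` sites of `B7Prop1Explicit` into this namespace.
export B7Prop1Explicit (Site)

variable {d : ℕ}

/-! ## §1 Rescaling `Lℤ^d ≅ ℤ^d` and configurations with values in a subgroup `G` -/

section Transport

variable {G : Type*}

/-- Rescaling: a configuration `W` on the bonds `⟨Lz, Lz + Le_κ⟩` of the `L`-lattice `Lℤ^d ⊂ ℤ^d`, read as a
configuration on the unit lattice, `(z, κ) ↦ W(Lz, κ)` — the identification `Ω^{(j+1)} = L^{j+1}ηZ^d ≅ ℤ^d` of the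
header's DICTIONARY (print: (1) `Ω^{(j)} = Ω ∩ L^jηZ^d`; p. 19 "`Ω^{(j)}` may be replaced by any other lattice").
[cite: Balaban1985Averaging, (1) p.17, p.19] -/
def rescale (L : ℕ) (W : Site d → Fin d → G) : Site d → Fin d → G := fun z κ => W ((L : ℤ) • z) κ

/-- `rescale_apply`: unfolding the rescaling. [folklore] -/
@[simp] theorem rescale_apply (L : ℕ) (W : Site d → Fin d → G) (z : Site d) (κ : Fin d) :
    rescale L W z κ = W ((L : ℤ) • z) κ := rfl

variable [Group G]

/-- A degenerate "plaquette word" `[+e_μ, +e_μ, −e_μ, −e_μ]` backtracks, so its holonomy is `1`. [folklore] -/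
theorem hol_plaqWord_self (V : Site d → Fin d → G) (z : Site d) (μ : Fin d) : hol V z (plaqWord μ μ) = 1 := by
  rw [show plaqWord μ μ = [(μ, true), (μ, true)] ++ revWord [(μ, true), (μ, true)] from rfl, hol_append,
    hol_revWord, mul_inv_cancel]

/-- Bond variables in a subgroup `S` ⟹ every letter's transport is in `S`. [folklore] -/
theorem stepHol_mem_of {S : Subgroup G} {V : Site d → Fin d → G} (hV : ∀ x κ, V x κ ∈ S) (x : Site d)
    (l : Letter d) : stepHol V x l ∈ S := by
  unfold stepHol
  split_ifs
  exacts [hV _ _, S.inv_mem (hV _ _)]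

/-- Bond variables in a subgroup `S` ⟹ every parallel transport (9) is in `S`. [folklore] -/
theorem hol_mem_of {S : Subgroup G} {V : Site d → Fin d → G} (hV : ∀ x κ, V x κ ∈ S) :
    ∀ (x : Site d) (w : List (Letter d)), hol V x w ∈ S
  | _, [] => S.one_mem
  | x, l :: w => S.mul_mem (stepHol_mem_of hV x l) (hol_mem_of hV _ w)

/-- Rescaling preserves `S`-valuedness. [folklore] -/
theorem rescale_mem_of {S : Subgroup G} {W : Site d → Fin d → G} (hW : ∀ x κ, W x κ ∈ S) (L : ℕ)
    (z : Site d) (κ : Fin d) : rescale L W z κ ∈ S :=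
  hW _ _

end Transport

/-! ## §2 The plaquette deviation `sup_p |V(∂p) − 1|` of a configuration -/

section Dev

variable {𝔸 : Type*} [NormedRing 𝔸]

/-- `sup_p |V(∂p) − 1|` over all unit plaquettes `p = (x; κ, κ′)` of `ℤ^d` (the quantity bounded in (44), (52), (53),
(54); a real supremum, `= 0` if unbounded — it is bounded by `2` for configurations in `{|u| ≤ 1, |u⁻¹| ≤ 1}`).
[cite: Balaban1985Averaging, (44) p.24, (52)–(54) p.26] -/
def pdev (V : Site d → Fin d → 𝔸ˣ) : ℝ :=
  ⨆ p : Site d × Fin d × Fin d, ‖((hol V p.1 (plaqWord p.2.1 p.2.2) : 𝔸ˣ) : 𝔸) - 1‖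

/-- `pdev_nonneg`: a supremum of norms is `≥ 0`. [folklore] -/
theorem pdev_nonneg (V : Site d → Fin d → 𝔸ˣ) : 0 ≤ pdev V := by
  unfold pdev
  exact Real.iSup_nonneg fun _ => norm_nonneg _

variable [NormOneClass 𝔸]

/-- For a configuration with values in `{|u| ≤ 1, |u⁻¹| ≤ 1}` every `|V(∂p) − 1| ≤ 2`, so the supremum `pdev` is a
genuine one. [folklore] -/
theorem pdev_bddAbove {V : Site d → Fin d → 𝔸ˣ} (hV : ∀ x κ, V x κ ∈ U1 𝔸) :
    BddAbove (Set.range fun p : Site d × Fin d × Fin d =>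
      ‖((hol V p.1 (plaqWord p.2.1 p.2.2) : 𝔸ˣ) : 𝔸) - 1‖) := by
  refine ⟨2, ?_⟩
  rintro _ ⟨p, rfl⟩
  refine (norm_sub_le _ _).trans ?_
  rw [norm_one]
  have := (hol_mem hV p.1 (plaqWord p.2.1 p.2.2)).1
  linarith

/-- `|V(∂p) − 1| ≤ pdev V` for every unit plaquette. [folklore] -/
theorem le_pdev {V : Site d → Fin d → 𝔸ˣ} (hV : ∀ x κ, V x κ ∈ U1 𝔸) (x : Site d) (κ κ' : Fin d) :
    ‖((hol V x (plaqWord κ κ') : 𝔸ˣ) : 𝔸) - 1‖ ≤ pdev V :=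
  le_ciSup (pdev_bddAbove hV) (x, κ, κ')

end Dev

/-! ## §3 The constants of Proposition 1 and the `k`-fold average (43) -/

/-- The explicit constant `C₀ = C₀(d) = 226·(8(d+1)(d+4))² = 14464(d+1)²(d+4)²` of Prop. 1 (51) certified in
`B7Prop1Explicit.prop1_explicit` (print p. 26: "The constant `C₀` depends on `d`").
[cite: Balaban1985Averaging, Prop. 1 (51) p.26] -/
def C0 (d : ℕ) : ℝ := 226 * (8 * ((d : ℝ) + 1) * (d + 4)) ^ 2

/-- The explicit constant `c₂′ = c₂′(d, L) = 1/(512(d+1)(d+4)L²)` of Prop. 1 (51) certified in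
`B7Prop1Explicit.prop1_explicit` (print p. 26: "`c₂′` depends on `d` and `L`").
[cite: Balaban1985Averaging, Prop. 1 (51) p.26] -/
def c2' (d L : ℕ) : ℝ := 1 / (512 * ((d : ℝ) + 1) * (d + 4) * (L : ℝ) ^ 2)

/-- `C0_pos`: the constant is positive. [folklore] -/
theorem C0_pos (d : ℕ) : 0 < C0 d := by
  unfold C0; positivity

/-- `c2'_pos`: the constant is positive for `L ≥ 1`. [folklore] -/
theorem c2'_pos (d L : ℕ) (hL : 1 ≤ L) : 0 < c2' d L := by
  have : (1 : ℝ) ≤ L := by exact_mod_cast hL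
  unfold c2'; positivity

/-- Pure arithmetic behind "(53) for `j ≤ k` ⟹ the level-`j` deviation is `< α₀ + 2C₀α₀²`": with `t = L^jη ≤ 1` and the
bracket `S ≤ 2`. [folklore] -/
theorem bound53_le {C₀ α₀ t S : ℝ} (hC : 0 ≤ C₀) (hα : 0 ≤ α₀) (ht0 : 0 ≤ t) (ht : t ≤ 1)
    (hS0 : 0 ≤ S) (hS : S ≤ 2) :
    α₀ * t ^ 2 + C₀ * (α₀ * t ^ 2) ^ 2 * S ≤ α₀ + 2 * C₀ * α₀ ^ 2 := by
  have ht2 : t ^ 2 ≤ 1 := pow_le_one₀ ht0 ht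
  have hx : α₀ * t ^ 2 ≤ α₀ := mul_le_of_le_one_right hα ht2
  have hx0 : 0 ≤ α₀ * t ^ 2 := by positivity
  have h1 : (α₀ * t ^ 2) ^ 2 ≤ α₀ ^ 2 := pow_le_pow_left₀ hx0 hx 2
  have h2 : C₀ * (α₀ * t ^ 2) ^ 2 * S ≤ C₀ * α₀ ^ 2 * 2 :=
    mul_le_mul (mul_le_mul_of_nonneg_left h1 hC) hS hS0 (by positivity)
  linarith

section Main

variable {𝔸 : Type*} [NormedRing 𝔸] [NormOneClass 𝔸] [NormedAlgebra ℂ 𝔸] [CompleteSpace 𝔸]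

omit [NormOneClass 𝔸] [NormedAlgebra ℂ 𝔸] [CompleteSpace 𝔸] in
/-- Under the rescaling `Lℤ^d ≅ ℤ^d`, the unit plaquette variable of `rescale L W` at `z` is the `L`-plaquette
variable `W(∂p′)`, `p′ ⊂ Ω′^{(1)}`, of `W` at `Lz` — the quantity bounded in (51). [cite: Balaban1985Averaging, (1) p.17, (51) p.26] -/
theorem hol_rescale_plaqWord (L : ℕ) (W : Site d → Fin d → 𝔸ˣ) (z : Site d) (μ ν : Fin d) :
    hol (rescale L W) z (plaqWord μ ν) = cplaq L W ((L : ℤ) • z) μ ν := by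
  have h2 : z + e μ + e ν - e μ = z + e ν := by abel
  have h3 : z + e μ + e ν + -e μ - e ν = z := by abel
  simp only [plaqWord, hol_cons, hol_nil, mul_one, stepHol_true, stepHol_false, Letter.vec_true,
    Letter.vec_false, rescale_apply, cplaq, h2, h3, smul_add, mul_assoc]

/-- **(43) p. 24, the `k`-fold average as the iterate of the one-step average (42):** "if `k`-th order averaging
`Ū^k` is defined at bonds of `Ω^{(k)}`, then `Ū^{k+1}_c = \overline{(Ū^k)}_c = exp[i Σ_{x∈B(c₋)} L^{−d} (1/i)
log Ū^k(Γ_{c,x})(Ū^k(c))⁻¹] Ū^k(c)`, `c ⊂ Ω^{(k+1)}`, (43) where the contours `Γ_{c,x}` are defined on the lattice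
`Ω^{(k)}`."  Here every level `Ω^{(j)} = L^jηZ^d` is identified with `ℤ^d` (header DICTIONARY): `avgIter L V (j+1) =
rescale L (bavg L (avgIter L V j))`, `avgIter L V 0 = V`. [cite: Balaban1985Averaging, (43) p.24] -/
def avgIter (L : ℕ) (V : Site d → Fin d → 𝔸ˣ) : ℕ → Site d → Fin d → 𝔸ˣ
  | 0 => V
  | j + 1 => rescale L (bavg L (avgIter L V j))

omit [NormOneClass 𝔸] in
/-- `avgIter_zero`: `Ū^0 = U`. [cite: Balaban1985Averaging, (43) p.24] -/
@[simp] theorem avgIter_zero (L : ℕ) (V : Site d → Fin d → 𝔸ˣ) : avgIter L V 0 = V := rfl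

omit [NormOneClass 𝔸] in
/-- `avgIter_succ`: `Ū^{k+1} = \overline{(Ū^k)}` (43). [cite: Balaban1985Averaging, (43) p.24] -/
theorem avgIter_succ (L : ℕ) (V : Site d → Fin d → 𝔸ˣ) (j : ℕ) :
    avgIter L V (j + 1) = rescale L (bavg L (avgIter L V j)) := rfl

variable (d) in
/-- CLOSURE OF THE GAUGE GROUP UNDER THE AVERAGE (tacit in print, where `G = U(N)` and (42)–(43) are
`U(N)`-valued by (22)–(23)): a subgroup `G` of `{|u| ≤ 1, |u⁻¹| ≤ 1}` such that the one-step average (42) of a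
`G`-valued configuration is `G`-valued at every `L`-bond `c` all of whose `V(Γ_{c,x})V(c)⁻¹`, `x ∈ B(c₋)`, lie
within `1/4` of `1` (inside the domain of the series (21)).  The unitary group of any C⋆-algebra qualifies
(`avgClosed_unitaryUnits` below); this is the only property of `G` the proof of Prop. 2 needs beyond Prop. 1.
[cite: Balaban1985Averaging, (42)–(43) pp.23–24] -/
structure AvgClosed (L : ℕ) (G : Subgroup 𝔸ˣ) : Prop where
  le_U1 : G ≤ U1 𝔸
  bavg_mem : ∀ (V : Site d → Fin d → 𝔸ˣ), (∀ x κ, V x κ ∈ G) → ∀ (q : Site d) (κ : Fin d),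
    (∀ r : Fin d → Fin L, ‖((Wcx L V q κ (boxVec L r) : 𝔸ˣ) : 𝔸) - 1‖ ≤ 1 / 4) → bavg L V q κ ∈ G

/-! ### The smallness of `V(Γ_{c,x})V(c)⁻¹` under (44) (p. 25), for every bond of the `L`-lattice -/

/-- **p. 25, "`|V₀(Γ_{c,x}) − 1| < |Γ_{c,x}| dLα₀ < (2d+1)LdLα₀ = O(1)L²α₀`", quantified and gauge-free:** under (44)
with `512(d+1)(d+4)L²α₀ ≤ 1`, for EVERY `L`-bond `c = ⟨q, q + Le_κ⟩` of `ℤ^d` and every `x ∈ B(c₋)`,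
`|V(Γ_{c,x})V(c)⁻¹ − 1| ≤ 2θ`, `θ = 8(d+1)(d+4)L²α₀` — the last clause of `B7Prop1Explicit.side_estimate` in the axial
gauge at `y = q + 2Le_κ`, transported back by (11) (`Wcx_gaugeAct`: the loop variable is conjugated by
`u(q) ∈ {|u| ≤ 1, |u⁻¹| ≤ 1}`). [cite: Balaban1985Averaging, p.25 (displays before (47))] -/
theorem norm_Wcx_sub_one_le (L : ℕ) (hL : 1 ≤ L) (V : Site d → Fin d → 𝔸ˣ) (hV : ∀ x κ, V x κ ∈ U1 𝔸)
    {α₀ : ℝ} (hα₀ : 0 ≤ α₀) (hsmall : 512 * (d + 1) * (d + 4) * (L : ℝ) ^ 2 * α₀ ≤ 1)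
    (h44 : ∀ (x : Site d) (κ κ' : Fin d), κ ≠ κ' → ‖((hol V x (plaqWord κ κ') : 𝔸ˣ) : 𝔸) - 1‖ ≤ α₀)
    (q : Site d) (κ : Fin d) (r : Fin d → Fin L) :
    ‖((Wcx L V q κ (boxVec L r) : 𝔸ˣ) : 𝔸) - 1‖ ≤ 2 * (8 * (d + 1) * (d + 4) * (L : ℝ) ^ 2 * α₀) := by
  have hd : 1 ≤ d := κ.pos
  set y : Site d := q + (L : ℤ) • e κ + (L : ℤ) • e κ with hy
  set u : Site d → 𝔸ˣ := axialFn V y with hu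
  set V₀ : Site d → Fin d → 𝔸ˣ := gaugeAct u V with hV₀
  have huU : ∀ x, u x ∈ U1 𝔸 := fun x => axialFn_mem hV y x
  have hbond : ∀ x κ', l1 (x - y) ≤ (2 * d + 4) * L + 4 → ‖((V₀ x κ' : 𝔸ˣ) : 𝔸) - 1‖ ≤ l1 (x - y) * α₀ :=
    fun x κ' _ => axial_bond_bound V hV y h44 hα₀ x κ'
  -- the constants, as in `B7Prop1Explicit.prop1_core`
  set R : ℕ := (2 * d + 4) * L + 4 with hRdef
  set a : ℝ := 4 * (d + 4) * L * α₀ with hadef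
  set θ : ℝ := 8 * (d + 1) * (d + 4) * (L : ℝ) ^ 2 * α₀ with hθdef
  have hLr : (1 : ℝ) ≤ L := by exact_mod_cast hL
  have hdr : (1 : ℝ) ≤ d := by exact_mod_cast hd
  have ha : 0 ≤ a := by positivity
  have hθ0 : 0 ≤ θ := by positivity
  have hθ1 : θ ≤ 1 / 64 := by
    have : 64 * θ = 512 * (d + 1) * (d + 4) * (L : ℝ) ^ 2 * α₀ := by rw [hθdef]; ring
    linarith
  have haθ : 4 * a ≤ θ := by
    have e1 : θ - 4 * a = 8 * ((d : ℝ) + 4) * L * α₀ * ((d + 1) * L - 2) := by rw [hθdef, hadef]; ring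
    have e2 : 0 ≤ 8 * ((d : ℝ) + 4) * L * α₀ * ((d + 1) * L - 2) :=
      mul_nonneg (by positivity) (by nlinarith [mul_nonneg (sub_nonneg.mpr hdr) (by positivity : (0 : ℝ) ≤ L)])
    linarith
  have ha1 : a ≤ 1 := by linarith
  have hRa : ((R : ℕ) : ℝ) * α₀ ≤ a / 2 := by
    have e1 : a / 2 - ((R : ℕ) : ℝ) * α₀ = 4 * ((L : ℝ) - 1) * α₀ := by rw [hRdef, hadef]; push_cast; ring
    have e2 : 0 ≤ 4 * ((L : ℝ) - 1) * α₀ := mul_nonneg (mul_nonneg (by norm_num) (by linarith)) hα₀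
    linarith
  have hb : ∀ x κ', l1 (x - y) ≤ R → ‖((V₀ x κ' : 𝔸ˣ) : 𝔸) - 1‖ ≤ a / 2 := fun x κ' hx =>
    (hbond x κ' hx).trans ((mul_le_mul_of_nonneg_right (by exact_mod_cast hx) hα₀).trans hRa)
  have hVA := bond_log y R ha1 hb
  have hθN : ((2 * (d * L) + L + L : ℕ) : ℝ) * a ≤ θ := le_of_eq (by rw [hadef, hθdef]; push_cast; ring)
  have hRexp : R = 2 * (d * L) + 4 * L + 4 := by rw [hRdef]; ring
  have hqy : l1 (q - y) ≤ 2 * L := by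
    rw [hy, show q - (q + (L : ℤ) • e κ + (L : ℤ) • e κ) = -((L : ℤ) • e κ + (L : ℤ) • e κ) by abel, l1_neg]
    refine (l1_add_le _ _).trans ?_
    rw [l1_zsmul_e, Int.natAbs_natCast]; omega
  have hside := side_estimate V₀ (fun x κ' => MatrixLog.mlog ((V₀ x κ' : 𝔸ˣ) : 𝔸)) y R ha hVA L hL q κ
    (by rw [hRexp]; omega) hθN hθ0 hθ1
  have hW₀ := hside.2.2.2.2 r
  -- back to `V` by (11): `V₀(Γ_{c,x})V₀(c)⁻¹ = u(q) · V(Γ_{c,x})V(c)⁻¹ · u(q)⁻¹`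
  refine (norm_sub_one_le_of_conj (X := Wcx L V q κ (boxVec L r)) (huU q)).trans ?_
  rw [← Wcx_gaugeAct]
  exact hW₀

/-! ### One step of (53): Proposition 1 at level `j`, for all plaquettes of the next lattice -/

/-- **The induction step of (53)** (p. 26: (53) "by induction" from (51)): if a configuration `W` with values in
`G ⊂ {|u| ≤ 1, |u⁻¹| ≤ 1}` has `sup_p |W(∂p) − 1| < P ≤ c₂′`, then its rescaled one-step average has
`sup_{p′} |W̄(∂p′) − 1| < L²P + C₀(L²P)²` — Prop. 1 (`B7Prop1Explicit.prop1_explicit`) at every plaquette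
`p′` of the `L`-lattice (the degenerate words `μ = ν` contribute `0`), then the supremum. [cite: Balaban1985Averaging, (51)–(53) p.26] -/
theorem step_lt (L : ℕ) (hL : 1 ≤ L) {G : Subgroup 𝔸ˣ} (hGU : G ≤ U1 𝔸) (W : Site d → Fin d → 𝔸ˣ)
    (hW : ∀ x κ, W x κ ∈ G) {P : ℝ} (hPc : P ≤ c2' d L) (hWP : pdev W < P) :
    pdev (rescale L (bavg L W)) < (L : ℝ) ^ 2 * P + C0 d * ((L : ℝ) ^ 2 * P) ^ 2 := by
  have hU : ∀ x κ, W x κ ∈ U1 𝔸 := fun x κ => hGU (hW x κ)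
  have hLr : (1 : ℝ) ≤ L := by exact_mod_cast hL
  set α := pdev W with hαdef
  have hα0 : 0 ≤ α := pdev_nonneg W
  have hpos : (0 : ℝ) < 512 * ((d : ℝ) + 1) * (d + 4) * (L : ℝ) ^ 2 := by positivity
  have hsmall : 512 * (d + 1) * (d + 4) * (L : ℝ) ^ 2 * α ≤ 1 := by
    have h1 : α ≤ 1 / (512 * ((d : ℝ) + 1) * (d + 4) * (L : ℝ) ^ 2) := hWP.le.trans hPc
    rw [le_div_iff₀ hpos] at h1
    linarith
  have h44 : ∀ (x : Site d) (κ κ' : Fin d), κ ≠ κ' → ‖((hol W x (plaqWord κ κ') : 𝔸ˣ) : 𝔸) - 1‖ ≤ α :=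
    fun x κ κ' _ => le_pdev hU x κ κ'
  have hB0 : 0 ≤ (L : ℝ) ^ 2 * α + 226 * (8 * (d + 1) * (d + 4) * (L : ℝ) ^ 2 * α) ^ 2 := by positivity
  have hle : pdev (rescale L (bavg L W))
      ≤ (L : ℝ) ^ 2 * α + 226 * (8 * (d + 1) * (d + 4) * (L : ℝ) ^ 2 * α) ^ 2 := by
    refine Real.iSup_le (fun p => ?_) hB0
    obtain ⟨z, μ, ν⟩ := p
    dsimp only
    by_cases hμν : μ = ν
    · subst hμν
      rw [hol_plaqWord_self, Units.val_one, sub_self, norm_zero]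
      exact hB0
    · rw [hol_rescale_plaqWord]
      exact prop1_explicit L hL ((L : ℤ) • z) hμν W hU hα0 hsmall h44
  refine hle.trans_lt ?_
  have hL2 : (0 : ℝ) < (L : ℝ) ^ 2 := by positivity
  have h1 : (L : ℝ) ^ 2 * α < (L : ℝ) ^ 2 * P := by gcongr
  have h2 : (8 * ((d : ℝ) + 1) * (d + 4) * (L : ℝ) ^ 2 * α) ^ 2
      ≤ (8 * ((d : ℝ) + 1) * (d + 4) * (L : ℝ) ^ 2 * P) ^ 2 := by
    gcongr
  have hC : C0 d * ((L : ℝ) ^ 2 * P) ^ 2 = 226 * (8 * ((d : ℝ) + 1) * (d + 4) * (L : ℝ) ^ 2 * P) ^ 2 := by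
    unfold C0; ring
  rw [hC]
  linarith

/-- `step_lt` for the iterate: the hypothesis `step` of `B7.ineq53_induction` at level `j`, PROVIDED `Ū^j` is
`G`-valued. [cite: Balaban1985Averaging, (53) p.26] -/
theorem step_avgIter (L : ℕ) (hL : 1 ≤ L) {G : Subgroup 𝔸ˣ} (hGU : G ≤ U1 𝔸) (V : Site d → Fin d → 𝔸ˣ)
    (j : ℕ) (hj : ∀ x κ, avgIter L V j x κ ∈ G) (P : ℝ) (_hP : 0 < P) (hPc : P ≤ c2' d L)
    (hjP : pdev (avgIter L V j) < P) :
    pdev (avgIter L V (j + 1)) < (L : ℝ) ^ 2 * P + C0 d * ((L : ℝ) ^ 2 * P) ^ 2 :=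
  step_lt L hL hGU _ hj hPc hjP

/-! ### Proposition 2: all levels stay in the small-field region, and (53), (54) -/

/-- **The `G`-valuedness of all `Ū^j`, `j ≤ k`** (tacit in print): under (52) and `α₀ ≤ c₂`, by induction on `j`,
using (53) at level `j` (`B7.ineq53_induction` applied with `k := j`) to see that `Ū^j` satisfies (44) with a
constant `< 2α₀ ≤ c₂′`, hence (`norm_Wcx_sub_one_le`) all `Ū^j(Γ_{c,x})Ū^j(c)⁻¹` lie within `1/32` of `1`, and
the closure property `AvgClosed`. [cite: Balaban1985Averaging, (52)–(53) p.26] -/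
theorem avgIter_mem (L : ℕ) (hL : 2 ≤ L) {G : Subgroup 𝔸ˣ} (hG : AvgClosed d L G) (k : ℕ)
    (V : Site d → Fin d → 𝔸ˣ) (hV : ∀ x κ, V x κ ∈ G) {α₀ : ℝ} (hα : 0 < α₀)
    (hα3 : C0 d * α₀ ≤ 1 / 3) (hα2 : 2 * α₀ ≤ c2' d L)
    (h52 : pdev V < α₀ * (((L : ℝ) ^ k)⁻¹) ^ 2) :
    ∀ j ≤ k, ∀ x κ, avgIter L V j x κ ∈ G := by
  have hL1 : 1 ≤ L := le_trans (by norm_num) hL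
  have hLr : (2 : ℝ) ≤ L := by exact_mod_cast hL
  have hL1r : (1 : ℝ) ≤ L := by linarith
  have hC := C0_pos d
  set η : ℝ := ((L : ℝ) ^ k)⁻¹ with hη
  have hη0 : 0 < η := by positivity
  set a : ℕ → ℝ := fun j => pdev (avgIter L V j) with hadef
  have h52' : a 0 < α₀ * η ^ 2 := h52
  have hr0 : 0 ≤ (1 + C0 d * α₀) ^ 2 / (L : ℝ) ^ 2 := by positivity
  have hrhalf : (1 + C0 d * α₀) ^ 2 / (L : ℝ) ^ 2 ≤ 1 / 2 :=
    (B7.prop2_ratio_lt_half (C0 d) α₀ L hLr (mul_nonneg hC.le hα.le) hα3).le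
  -- induction on the level, carrying the `G`-valuedness of ALL lower levels
  suffices H : ∀ j, j ≤ k → ∀ i ≤ j, ∀ x κ, avgIter L V i x κ ∈ G from fun j hj => H j hj j le_rfl
  intro j
  induction j with
  | zero =>
      intro _ i hi
      obtain rfl : i = 0 := Nat.le_zero.mp hi
      simpa using hV
  | succ j ih =>
      intro hjk i hi
      have hjk' : j ≤ k := Nat.le_of_succ_le hjk
      have ihj := ih hjk'
      rcases Nat.lt_or_eq_of_le hi with hlt | rfl
      · exact ihj i (Nat.lt_succ_iff.mp hlt)
      -- the new level `j + 1`: first (53) at level `j`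
      have hstep : ∀ i < j, ∀ P : ℝ, 0 < P → P ≤ c2' d L → a i < P →
          a (i + 1) < (L : ℝ) ^ 2 * P + C0 d * ((L : ℝ) ^ 2 * P) ^ 2 :=
        fun i hi P hP hPc hiP => step_avgIter L hL1 hG.le_U1 V i (ihj i hi.le) P hP hPc hiP
      have hηj : (L : ℝ) ^ j * η ≤ 1 := by
        rw [hη, ← div_eq_mul_inv, div_le_one (by positivity)]
        exact pow_le_pow_right₀ hL1r hjk'
      have h53 := B7.ineq53_induction (L : ℝ) η α₀ (C0 d) (c2' d L) j a hLr hη0 hηj (C0_pos d) hα hα3 hα2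
        h52' hstep j le_rfl
      have hS0 : 0 ≤ ∑ i ∈ Finset.range j, ((1 + C0 d * α₀) ^ 2 / (L : ℝ) ^ 2) ^ i :=
        Finset.sum_nonneg fun i _ => pow_nonneg hr0 i
      have hS2 := B7.geom_bracket_le_two _ hr0 hrhalf j
      have hbound : a j < α₀ + 2 * C0 d * α₀ ^ 2 :=
        h53.trans_le (bound53_le (C0_pos d).le hα.le (by positivity) hηj hS0 hS2)
      have htwo := B7.prop2_bound_lt_two_alpha (C0 d) α₀ hα hα3
      -- so `Ū^j` satisfies (44) with `α := a j < 2α₀ ≤ c₂′`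
      have hU : ∀ x κ, avgIter L V j x κ ∈ U1 𝔸 := fun x κ => hG.le_U1 (ihj j le_rfl x κ)
      have hαj0 : 0 ≤ a j := pdev_nonneg _
      have hpos : (0 : ℝ) < 512 * ((d : ℝ) + 1) * (d + 4) * (L : ℝ) ^ 2 := by positivity
      have hsmall : 512 * (d + 1) * (d + 4) * (L : ℝ) ^ 2 * a j ≤ 1 := by
        have h1 : a j ≤ 1 / (512 * ((d : ℝ) + 1) * (d + 4) * (L : ℝ) ^ 2) := by
          have : a j ≤ c2' d L := by linarith
          exact this
        rw [le_div_iff₀ hpos] at h1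
        linarith
      have h44 : ∀ (x : Site d) (κ κ' : Fin d), κ ≠ κ' →
          ‖((hol (avgIter L V j) x (plaqWord κ κ') : 𝔸ˣ) : 𝔸) - 1‖ ≤ a j :=
        fun x κ κ' _ => le_pdev hU x κ κ'
      have hWcx : ∀ (q : Site d) (κ : Fin d) (r : Fin d → Fin L),
          ‖((Wcx L (avgIter L V j) q κ (boxVec L r) : 𝔸ˣ) : 𝔸) - 1‖ ≤ 1 / 4 := by
        intro q κ r
        refine (norm_Wcx_sub_one_le L hL1 _ hU hαj0 hsmall h44 q κ r).trans ?_
        have : 2 * (8 * ((d : ℝ) + 1) * (d + 4) * (L : ℝ) ^ 2 * a j)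
            = (512 * ((d : ℝ) + 1) * (d + 4) * (L : ℝ) ^ 2 * a j) / 32 := by ring
        rw [this]
        linarith
      intro x κ
      rw [avgIter_succ, rescale_apply]
      exact hG.bavg_mem _ (ihj j le_rfl) _ κ (hWcx _ κ)

/-- **(53) p. 26 for the concrete `k`-fold average (43), kernel-checked:** under (52)
`sup_p |U(∂p) − 1| < α₀η²`, `η = L^{−k}`, and `α₀ ≤ c₂ = min{1/(3C₀), ½c₂′}` (as `C₀α₀ ≤ ⅓`, `2α₀ ≤ c₂′`), for all
`j ≤ k`: `sup_{p ⊂ Ω^{(j)}} |Ū^j(∂p) − 1| < α₀(L^jη)² + C₀(α₀(L^jη)²)²·[1 + L^{−2}(1+C₀α₀)² + … +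
(L^{−2}(1+C₀α₀)²)^{j−1}]` — `B7.ineq53_induction` with its `step` discharged by Prop. 1 at every level
(`step_avgIter`, `avgIter_mem`). [cite: Balaban1985Averaging, (53) p.26] -/
theorem ineq53_explicit (L : ℕ) (hL : 2 ≤ L) {G : Subgroup 𝔸ˣ} (hG : AvgClosed d L G) (k : ℕ)
    (V : Site d → Fin d → 𝔸ˣ) (hV : ∀ x κ, V x κ ∈ G) {α₀ : ℝ} (hα : 0 < α₀)
    (hα3 : C0 d * α₀ ≤ 1 / 3) (hα2 : 2 * α₀ ≤ c2' d L)
    (h52 : pdev V < α₀ * (((L : ℝ) ^ k)⁻¹) ^ 2) :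
    ∀ j ≤ k, pdev (avgIter L V j) < α₀ * ((L : ℝ) ^ j * ((L : ℝ) ^ k)⁻¹) ^ 2 +
      C0 d * (α₀ * ((L : ℝ) ^ j * ((L : ℝ) ^ k)⁻¹) ^ 2) ^ 2 *
        ∑ i ∈ Finset.range j, ((1 + C0 d * α₀) ^ 2 / (L : ℝ) ^ 2) ^ i := by
  have hL1 : 1 ≤ L := le_trans (by norm_num) hL
  have hLr : (2 : ℝ) ≤ L := by exact_mod_cast hL
  have hL1r : (1 : ℝ) ≤ L := by linarith
  have hmem := avgIter_mem L hL hG k V hV hα hα3 hα2 h52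
  have hηk : (L : ℝ) ^ k * ((L : ℝ) ^ k)⁻¹ ≤ 1 := by
    rw [mul_inv_cancel₀ (by positivity)]
  exact B7.ineq53_induction (L : ℝ) _ α₀ (C0 d) (c2' d L) k (fun j => pdev (avgIter L V j)) hLr
    (by positivity) hηk (C0_pos d) hα hα3 hα2 h52
    (fun j hj P hP hPc hjP => step_avgIter L hL1 hG.le_U1 V j (hmem j hj.le) P hP hPc hjP)

/-- **Proposition 2 (54) p. 26 for the concrete `k`-fold average (43), kernel-checked with explicit constants,
uniformly in `k`:** "If `U` satisfies (52) with `α₀ ≤ c₂ = min{1/(3C₀), ½c₂′}`, then `|Ū^k(∂p) − 1| < α₀ + 2C₀α₀²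
< 2α₀`, `p ⊂ Ω^{(k)}` (54)."  Here: `U` a configuration on `ℤ^d` (`L ≥ 2`) with values in an `AvgClosed`
group `G` (e.g. the unitary group of a C⋆-algebra, `prop2_unitaryUnits`), read on the unit lattice, with
`sup_p |U(∂p) − 1| < α₀η²`, `η = L^{−k}`; conclusion `sup_{p ⊂ Ω^{(k)}} |Ū^k(∂p) − 1| < α₀ + 2C₀α₀²` with
`C₀ = 14464(d+1)²(d+4)²`, `c₂′ = 1/(512(d+1)(d+4)L²)`; and every `Ū^j`, `j ≤ k`, is `G`-valued.  Proof = the printed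
one: (53) by induction from Prop. 1, "taking `j = k`" (`B7.prop2_of_ineq53`). [cite: Balaban1985Averaging, Prop. 2 (52)–(54) p.26] -/
theorem prop2_explicit (L : ℕ) (hL : 2 ≤ L) {G : Subgroup 𝔸ˣ} (hG : AvgClosed d L G) (k : ℕ)
    (V : Site d → Fin d → 𝔸ˣ) (hV : ∀ x κ, V x κ ∈ G) {α₀ : ℝ} (hα : 0 < α₀)
    (hα3 : C0 d * α₀ ≤ 1 / 3) (hα2 : 2 * α₀ ≤ c2' d L)
    (h52 : pdev V < α₀ * (((L : ℝ) ^ k)⁻¹) ^ 2) :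
    pdev (avgIter L V k) < α₀ + 2 * C0 d * α₀ ^ 2 ∧ ∀ j ≤ k, ∀ x κ, avgIter L V j x κ ∈ G := by
  have hL1 : 1 ≤ L := le_trans (by norm_num) hL
  have hLr : (2 : ℝ) ≤ L := by exact_mod_cast hL
  have hmem := avgIter_mem L hL hG k V hV hα hα3 hα2 h52
  refine ⟨?_, hmem⟩
  have hηk : (L : ℝ) ^ k * ((L : ℝ) ^ k)⁻¹ = 1 := mul_inv_cancel₀ (by positivity)
  exact B7.prop2_of_ineq53 (L : ℝ) _ α₀ (C0 d) (c2' d L) k (fun j => pdev (avgIter L V j)) hLr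
    (by positivity) hηk (C0_pos d) hα hα3 hα2 h52
    (fun j hj P hP hPc hjP => step_avgIter L hL1 hG.le_U1 V j (hmem j hj.le) P hP hPc hjP)

/-- The last inequality of (54): the bound is `< 2α₀` (so `Ū^k` again satisfies a hypothesis of type (44)/(52) —
"uniformly in `k`"). [cite: Balaban1985Averaging, Prop. 2 (54) p.26] -/
theorem prop2_explicit_lt_two (L : ℕ) (hL : 2 ≤ L) {G : Subgroup 𝔸ˣ} (hG : AvgClosed d L G)
    (k : ℕ) (V : Site d → Fin d → 𝔸ˣ) (hV : ∀ x κ, V x κ ∈ G) {α₀ : ℝ} (hα : 0 < α₀)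
    (hα3 : C0 d * α₀ ≤ 1 / 3) (hα2 : 2 * α₀ ≤ c2' d L)
    (h52 : pdev V < α₀ * (((L : ℝ) ^ k)⁻¹) ^ 2) :
    pdev (avgIter L V k) < 2 * α₀ :=
  (prop2_explicit L hL hG k V hV hα hα3 hα2 h52).1.trans (B7.prop2_bound_lt_two_alpha (C0 d) α₀ hα hα3)

end Main

/-! ## §4 The quoted leaf `B7.Prop2Printed`, instantiated and proved -/

section Concrete

variable {𝔸 : Type} [NormedRing 𝔸] [NormOneClass 𝔸] [NormedAlgebra ℂ 𝔸] [CompleteSpace 𝔸]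

variable (d 𝔸) in
/-- The concrete `k`-fold family of B7 Sect. B on `ηℤ^d` read on the unit lattice (header DICTIONARY: a
configuration `U` on `ηZ^d`, `η = L^{−k}`, is the configuration `V(x, κ) = U(⟨ηx, η(x + e_κ)⟩)` on `ℤ^d`): index
`i = k ∈ ℕ` (for fixed `d`, `L`, `G`); `Cfg` = `G`-valued configurations; `plaqDevEta U = sup_p |U(∂p) − 1| · η^{−2}
= pdev V · L^{2k}` (hypothesis (52)); `avgDevK U = sup_{p ⊂ Ω^{(k)}} |Ū^k(∂p) − 1| = pdev (avgIter L V k)` for the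
`k`-fold average (43) (conclusion (54)). [cite: Balaban1985Averaging, (1) p.17, (43) p.24, (52)–(54) p.26] -/
def concreteKStep (G : Subgroup 𝔸ˣ) (L k : ℕ) : B7.KStep where
  Cfg := {V : Site d → Fin d → 𝔸ˣ // ∀ x κ, V x κ ∈ G}
  k := k
  plaqDevEta V := pdev V.1 * ((L : ℝ) ^ k) ^ 2
  avgDevK V := pdev (avgIter L V.1 k)

/-- **Proposition 2 of B7 as printed (`B7.Prop2Printed`), PROVED for the concrete `k`-fold average (43) on `ℤ^d`**
(`L ≥ 2`) with values in any `AvgClosed` gauge group `G ⊂ {|u| ≤ 1, |u⁻¹| ≤ 1}` of a complete normed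
`ℂ`-algebra, with THE SAME constants `C₀ = 14464(d+1)²(d+4)²`, `c₂′ = 1/(512(d+1)(d+4)L²)` as the certified Prop. 1
(`B7Prop1Explicit.prop1Printed_concrete`) and `c₂ = min{1/(3C₀), ½c₂′}` exactly as printed; uniformly in the index
`k`. [cite: Balaban1985Averaging, Prop. 2 (52)–(54) p.26] -/
theorem prop2Printed_concrete (L : ℕ) (hL : 2 ≤ L) {G : Subgroup 𝔸ˣ} (hG : AvgClosed d L G) :
    B7.Prop2Printed (C0 d) (c2' d L) (fun k : ℕ => concreteKStep d 𝔸 G L k) := by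
  intro k α₀ hα₀ hαmin V h52
  obtain ⟨V, hV⟩ := V
  simp only [concreteKStep] at h52 ⊢
  have hC := C0_pos d
  have hα3 : C0 d * α₀ ≤ 1 / 3 := by
    have h := hαmin.trans (min_le_left _ _)
    rw [le_div_iff₀ (by positivity : (0 : ℝ) < 3 * C0 d)] at h
    linarith
  have hα2 : 2 * α₀ ≤ c2' d L := by
    have h := hαmin.trans (min_le_right _ _)
    linarith
  have hLk : (0 : ℝ) < ((L : ℝ) ^ k) ^ 2 := by positivity
  have h52' : pdev V < α₀ * (((L : ℝ) ^ k)⁻¹) ^ 2 := by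
    rw [inv_pow, ← div_eq_mul_inv, lt_div_iff₀ hLk]
    exact h52
  exact (prop2_explicit L hL hG k V hV hα₀ hα3 hα2 h52').1

end Concrete

/-! ## §5 The unitary group of a C⋆-algebra is closed under the average ((22)–(23): `log U = iA`, `A` hermitian) -/

section UnitaryGroup

variable {𝔸 : Type*} [Monoid 𝔸] [StarMul 𝔸]

/-- The paper's gauge group `G = U(N)` (p. 18, p. 23 "Let U be a gauge field configuration with values in U(N)"), in
any star-monoid (a C⋆-algebra below; `M_N(ℂ)` in print): the units whose value is unitary (`u⋆u = uu⋆ = 1`).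
[cite: Balaban1985Averaging, p.18, p.23] -/
def unitaryUnits (𝔸 : Type*) [Monoid 𝔸] [StarMul 𝔸] : Subgroup 𝔸ˣ where
  carrier := {u | (u : 𝔸) ∈ unitary 𝔸}
  mul_mem' := by
    intro u v hu hv
    simp only [Set.mem_setOf_eq, Units.val_mul] at *
    exact Submonoid.mul_mem _ hu hv
  one_mem' := by
    simp only [Set.mem_setOf_eq, Units.val_one]
    exact Submonoid.one_mem _
  inv_mem' := by
    intro u hu
    simp only [Set.mem_setOf_eq] at *
    have h : ((u⁻¹ : 𝔸ˣ) : 𝔸) = star (u : 𝔸) := by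
      calc ((u⁻¹ : 𝔸ˣ) : 𝔸) = ((u⁻¹ : 𝔸ˣ) : 𝔸) * ((u : 𝔸) * star (u : 𝔸)) := by
            rw [Unitary.mul_star_self_of_mem hu, mul_one]
        _ = star (u : 𝔸) := by rw [← mul_assoc, Units.inv_mul, one_mul]
    rw [h]
    exact Unitary.star_mem hu

/-- `mem_unitaryUnits`: membership unfolds to `u⋆u = uu⋆ = 1`. [folklore] -/
@[simp] theorem mem_unitaryUnits {u : 𝔸ˣ} : u ∈ unitaryUnits 𝔸 ↔ (u : 𝔸) ∈ unitary 𝔸 := Iff.rfl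

end UnitaryGroup

section Unitary

variable {𝔸 : Type*} [CStarAlgebra 𝔸]

/-- **(22)–(23) p. 21: the logarithm of a unitary close to `1` is `i`·(hermitian), i.e. skew-adjoint** — here for
the series (21) `log = MatrixLog.mlog` in any C⋆-algebra: if `u⋆u = uu⋆ = 1` and `|u − 1| ≤ 1/4` then
`(log u)⋆ = −log u`.  Proof: `X := log u` has `|X| ≤ 2|u − 1| ≤ ½ < ln 2` (26) and `e^X = u`; `e^{X⋆} = (e^X)⋆ = u⋆ =
u⁻¹ = e^{−X}`, and `log ∘ exp = id` on `|C| < ln 2` (`B7BlockAvgLog.mlog_exp`) gives `X⋆ = −X`. [cite: Balaban1985Averaging, (22)–(23) p.21] -/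
theorem star_mlog_eq_neg {u : 𝔸} (hu : u ∈ unitary 𝔸) (h : ‖u - 1‖ ≤ 1 / 4) : star (mlog u) = -mlog u := by
  set X := mlog u with hX
  have hXn : ‖X‖ ≤ 1 / 2 := (norm_mlog_le_two_mul (by linarith)).trans (by linarith)
  have hlog2 : (1 : ℝ) / 2 < Real.log 2 := by
    have := Real.log_two_gt_d9
    linarith
  have hexpX : exp X = u := exp_mlog (by linarith)
  have h1 : exp (-X) * exp X = 1 := (expUnit X).inv_val
  have hneg : exp (-X) = star u := by
    calc exp (-X) = exp (-X) * (u * star u) := by rw [Unitary.mul_star_self_of_mem hu, mul_one]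
      _ = (exp (-X) * exp X) * star u := by rw [hexpX, mul_assoc]
      _ = star u := by rw [h1, one_mul]
  have hstar : exp (star X) = star u := by rw [← star_exp, hexpX]
  calc star X = mlog (exp (star X)) :=
        (B7BlockAvgLog.mlog_exp (by rw [norm_star]; linarith)).symm
    _ = mlog (exp (-X)) := by rw [hstar, hneg]
    _ = -X := B7BlockAvgLog.mlog_exp (by rw [norm_neg]; linarith)

/-- **The average (42) of a `U(N)`-valued configuration is `U(N)`-valued** (tacit in print; it is what makes (43)
iterable): if every `V(Γ_{c,x})V(c)⁻¹`, `x ∈ B(c₋)`, lies within `1/4` of `1`, the exponent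
`X_c = Σ_x L^{−d} log[V(Γ_{c,x})V(c)⁻¹]` is skew-adjoint (a real combination of skew-adjoint elements), so `e^{X_c}` is
unitary (Mathlib `NormedSpace.exp_mem_unitary_of_mem_skewAdjoint`) and `V̄_c = e^{X_c} V(c)` is unitary. [cite: Balaban1985Averaging, (42) p.23, (22)–(23) p.21] -/
theorem bavg_mem_unitaryUnits {V : Site d → Fin d → 𝔸ˣ} (hV : ∀ x κ, V x κ ∈ unitaryUnits 𝔸) (L : ℕ)
    (q : Site d) (κ : Fin d)
    (hW : ∀ r : Fin d → Fin L, ‖((Wcx L V q κ (boxVec L r) : 𝔸ˣ) : 𝔸) - 1‖ ≤ 1 / 4) :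
    bavg L V q κ ∈ unitaryUnits 𝔸 := by
  have hWm : ∀ r : Fin d → Fin L, ((Wcx L V q κ (boxVec L r) : 𝔸ˣ) : 𝔸) ∈ unitary 𝔸 := fun r =>
    (unitaryUnits 𝔸).mul_mem (hol_mem_of hV _ _) ((unitaryUnits 𝔸).inv_mem (hol_mem_of hV _ _))
  have hX : Xavg L V q κ ∈ skewAdjoint 𝔸 := by
    unfold Xavg
    refine sum_mem fun r _ => skewAdjoint.smul_mem _ ?_
    rw [skewAdjoint.mem_iff]
    exact star_mlog_eq_neg (hWm r) (hW r)
  letI : NormedAlgebra ℚ 𝔸 := NormedAlgebra.restrictScalars ℚ ℂ 𝔸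
  have hexp : exp (Xavg L V q κ) ∈ unitary 𝔸 := NormedSpace.exp_mem_unitary_of_mem_skewAdjoint hX
  show exp (Xavg L V q κ) * ((hol V q (seg κ L) : 𝔸ˣ) : 𝔸) ∈ unitary 𝔸
  exact Submonoid.mul_mem _ hexp (hol_mem_of hV _ _)

variable [Nontrivial 𝔸]

/-- `U(N) ⊂ {|u| ≤ 1, |u⁻¹| ≤ 1}`: a unitary has operator norm (19) equal to `1`. [cite: Balaban1985Averaging, (19) p.21] -/
theorem unitaryUnits_le_U1 : unitaryUnits 𝔸 ≤ U1 𝔸 := by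
  intro u hu
  have hu' : u⁻¹ ∈ unitaryUnits 𝔸 := (unitaryUnits 𝔸).inv_mem hu
  exact ⟨(CStarRing.norm_of_mem_unitary hu).le, (CStarRing.norm_of_mem_unitary hu').le⟩

variable (d) in
/-- **The unitary group of a C⋆-algebra is an admissible gauge group for Prop. 2** (`AvgClosed`): it lies in
`{|u| ≤ 1, |u⁻¹| ≤ 1}` and is closed under the average (42). [cite: Balaban1985Averaging, (42)–(43) pp.23–24] -/
theorem avgClosed_unitaryUnits (L : ℕ) : AvgClosed d L (unitaryUnits 𝔸) :=
  ⟨unitaryUnits_le_U1, fun _ hV q κ hW => bavg_mem_unitaryUnits hV _ q κ hW⟩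

/-- **Proposition 2 (54) for `U(N)`-type gauge groups:** `prop2_explicit` for configurations with values in the
unitary group of a C⋆-algebra (`M_N(ℂ)` with the operator norm (19) and `G = U(N)` included). [cite: Balaban1985Averaging, Prop. 2 (52)–(54) p.26] -/
theorem prop2_unitaryUnits (L : ℕ) (hL : 2 ≤ L) (k : ℕ) (V : Site d → Fin d → 𝔸ˣ)
    (hV : ∀ x κ, V x κ ∈ unitaryUnits 𝔸) {α₀ : ℝ} (hα : 0 < α₀) (hα3 : C0 d * α₀ ≤ 1 / 3)
    (hα2 : 2 * α₀ ≤ c2' d L) (h52 : pdev V < α₀ * (((L : ℝ) ^ k)⁻¹) ^ 2) :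
    pdev (avgIter L V k) < α₀ + 2 * C0 d * α₀ ^ 2 ∧ ∀ j ≤ k, ∀ x κ, avgIter L V j x κ ∈ unitaryUnits 𝔸 :=
  prop2_explicit L hL (avgClosed_unitaryUnits d L) k V hV hα hα3 hα2 h52

end Unitary

section UnitaryConcrete

variable {𝔸 : Type} [CStarAlgebra 𝔸] [Nontrivial 𝔸]

/-- **`B7.Prop2Printed` PROVED for the concrete `k`-fold average (43) of unitary configurations on `ℤ^d`**
(`L ≥ 2`; `𝔸` any non-trivial C⋆-algebra, e.g. `M_N(ℂ)` with `G = U(N)`), with `C₀ = 14464(d+1)²(d+4)²`,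
`c₂′ = 1/(512(d+1)(d+4)L²)`, uniformly in `k`. [cite: Balaban1985Averaging, Prop. 2 (52)–(54) p.26] -/
theorem prop2Printed_unitaryUnits (L : ℕ) (hL : 2 ≤ L) :
    B7.Prop2Printed (C0 d) (c2' d L) (fun k : ℕ => concreteKStep d 𝔸 (unitaryUnits 𝔸) L k) :=
  prop2Printed_concrete L hL (avgClosed_unitaryUnits d L)

end UnitaryConcrete

/-! ## §6 The paper's own setting: `G = U(N) ⊂ M_N(ℂ)` with the operator norm (19) p. 21 -/

section Matrices

open scoped Matrix.Norms.L2Operator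

/-- **Proposition 2 of B7 for `G = U(N)`, `N ≥ 1`, verbatim setting:** configurations on `ℤ^d` with values in the
unitary group `U(N) ⊂ M_N(ℂ)`, `|·|` the operator norm (19) (Mathlib's `L²`-operator norm on `Matrix (Fin N) (Fin N) ℂ`,
scope `Matrix.Norms.L2Operator`, as everywhere in the cell), the `k`-fold average (43), constants
`C₀ = 14464(d+1)²(d+4)²`, `c₂′ = 1/(512(d+1)(d+4)L²)`, `L ≥ 2`, uniformly in `k`. [cite: Balaban1985Averaging, Prop. 2 (52)–(54) p.26] -/
theorem prop2Printed_unitaryGroup (N : ℕ) [NeZero N] (L : ℕ) (hL : 2 ≤ L) :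
    B7.Prop2Printed (C0 d) (c2' d L)
      (fun k : ℕ => concreteKStep d (Matrix (Fin N) (Fin N) ℂ) (unitaryUnits (Matrix (Fin N) (Fin N) ℂ)) L k) := by
  letI : CStarAlgebra (Matrix (Fin N) (Fin N) ℂ) := {}
  exact prop2Printed_concrete L hL (avgClosed_unitaryUnits d L)

end Matrices

end Literature.MathematicalPhysics.QuantumFieldTheory.Balaban1983to89.B7Prop2Explicit

end
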